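import Summits.ValiantsHypothesis.ValiantsHypothesis.Theorems.SymPencilPerFourOneRowKernel
import Summits.ValiantsHypothesis.ValiantsHypothesis.Theorems.SymPencilPerFourRowNoLinearFactor

/-!
# Route `SymPencil` — the one-row kernel kill at ONE kernel row, with a thirteenth range
# direction (tool for the cell `(13, 3, 0)` of the size-`27` table; `--supports`
# stmt-ValiantsHypothesis-5674, rung currency for `sdc(per_4)`, nothing here bears on `VP ≠ VNP`)

Abstract linear algebra over a field `K` of characteristic `0`.  DATA: the kernel package of a
symmetric affine determinantal representation of `per_4` read at every base point of the kernel
space (`D` invertible symmetric, `bL`, `CL` symmetric, `κ ≠ 0`, the first origin moment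
`bᵀD⁻¹CD⁻¹b ≡ 0`, and for `bL v = 0` the invertibility of `D + CL v` together with the
base-point pencil identity `κ · per_4 (v + s z) = det [[0, s bL(z)ᵀ], [s bL(z), D + CL v + s CL z]]`),
the row embeddings `embV` (a row `w ↦` the `4 × 4` matrix with that row) and `embX` (the other
three rows) with `per_4 (embV w + s · embX x) = s³ per [w; x]`, and — NEW with respect to
`SymPencilPerFourOneRowKernel.false_of_oneRow_embedding` — only ONE kernel row `w`
(`bL (embV w) = 0`, all `w_j ≠ 0`) with the invariance `CL(embV w) D⁻¹ (im bL) ⊆ im bL`, while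
`im bL` is spanned by `bL (embX ·)` and ONE further vector `n = bL (embV w₀)`.

**Theorem** (`false_of_oneRow_point`): these data do not exist.  With `u = D⁻¹ bL(embX x)` write
`CL(embV w) u = bL (embX (K x)) + c(x) n` (`K`, `c` linear).  The base-point identity along
`t ↦ t · embV w` at the point `z_t = embX (x + t K x) + t c(x) embV w₀` and
`SymPencilBasePointMoments.basepoint_moment` give the polynomial identity
`det (D + t CL(embV w)) · Φ(x) = κ · per [w; x + t K x]` with
`Φ(x) = uᵀ CL(embX (K x)) u + c(x) · uᵀ CL(embV w₀) u`; its `t⁰, t¹` coefficients and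
`SymPencilPerFourRowStabilizer.rowScaling_of_deriv_vanish` make `K` a row scaling
`x_a ↦ d_a x_a`, so that `per [w; x + t K x] = Π (1 + t d_a) per [w; x]`; if some `d_a ≠ 0` the
invertibility of `D + CL(t · embV w)` at `t = -1/d_a` forces `per [w; ·] ≡ 0`, absurd; if `d = 0`
the `t⁰` coefficient reads `det D · c(x) · uᵀ CL(embV w₀) u = κ per [w; x]`, a factorisation
`linear × quadratic` of `per [w; ·]` excluded by
`SymPencilPerFourRowNoLinearFactor.permanent_rows_ne_linear_mul_quadratic`.  (For `w₀ = 0` this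
is the four-dimensional one-row kernel kill again, with a shorter endgame.) [folklore]
-/

noncomputable section

-- single-conjunct layout: Sub = Summit, duplicated namespace component intended
set_option linter.dupNamespace false

namespace Summit.ValiantsHypothesis.ValiantsHypothesis.Theorems.SymPencilPerFourOneRowPoint

open Matrix Module Polynomial MvPolynomial
open Literature.Computability.AlgebraicComplexity
open Summit.ValiantsHypothesis.ValiantsHypothesis.Theorems.SymPencilHomogeneousDropTools
open Summit.ValiantsHypothesis.ValiantsHypothesis.Theorems.SymPencilLagrangianKernel
open Summit.ValiantsHypothesis.ValiantsHypothesis.Theorems.SymPencilBasePointMoments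
open Summit.ValiantsHypothesis.ValiantsHypothesis.Theorems.SymPencilPerFourInnerRankRows
open Summit.ValiantsHypothesis.ValiantsHypothesis.Theorems.SymPencilPerFourRowForms
open Summit.ValiantsHypothesis.ValiantsHypothesis.Theorems.SymPencilPerFourRowStabilizer
open Summit.ValiantsHypothesis.ValiantsHypothesis.Theorems.SymPencilPerFourOneRowEndgame
open Summit.ValiantsHypothesis.ValiantsHypothesis.Theorems.SymPencilPerFourOneRowKernel
open Summit.ValiantsHypothesis.ValiantsHypothesis.Theorems.SymPencilPerFourRowNoLinearFactor

universe u

variable {K : Type u} [Field K]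

/-- Additivity of `per [a; b; v; w]` in the first row. [folklore] -/
theorem per_add_row₀ (a a' b v w : Fin 4 → K) :
    (Matrix.of ![a + a', b, v, w]).permanent =
      (Matrix.of ![a, b, v, w]).permanent + (Matrix.of ![a', b, v, w]).permanent := by
  simp only [permanent_of_rows, Pi.add_apply]; ring

/-- Scaling the three free rows of `per [v; x 0; x 1; x 2]`. [folklore] -/
theorem permanent_rows_scale (v : Fin 4 → K) (x : Fin 3 → Fin 4 → K) (d : Fin 3 → K) (t : K) :
    (Matrix.of ![v, (1 + t * d 0) • x 0, (1 + t * d 1) • x 1, (1 + t * d 2) • x 2]).permanent =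
      (1 + t * d 0) * (1 + t * d 1) * (1 + t * d 2) *
        (Matrix.of ![v, x 0, x 1, x 2]).permanent := by
  rw [permanent_rows_smul₁, per_smul_row₂, per_smul_row₃]; ring

variable [CharZero K] {ι' : Type*} [Fintype ι'] [DecidableEq ι']

/-- **The base-point identity along one kernel row.**  DATA as in the module docstring, a kernel
row `w`, and linear `K`, `c` with `bL (embX (K x)) + c(x) · bL (embV w₀) = CL(embV w) D⁻¹ bL(embX x)`.
CONCLUSION: for all `x, t`, with `u = D⁻¹ bL(embX x)`,
`det (D + t CL(embV w)) · t · uᵀ CL(embX (K x) + c(x) embV w₀) u = κ t · per [w; x + t K x]`.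
[folklore] -/
theorem pencil_identity {D : Matrix ι' ι' K} (hD : IsUnit D.det) (hDs : Dᵀ = D)
    (bL : (Fin 4 × Fin 4 → K) →ₗ[K] (ι' → K))
    (CL : (Fin 4 × Fin 4 → K) →ₗ[K] Matrix ι' ι' K) (hCs : ∀ z, (CL z)ᵀ = CL z) {κ : K}
    (hii : ∀ z, bL z ⬝ᵥ (D⁻¹ * CL z * D⁻¹) *ᵥ bL z = 0)
    (hN : ∀ v, bL v = 0 → IsUnit (D + CL v).det ∧ ∀ (z : Fin 4 × Fin 4 → K) (s : K),
      κ * MvPolynomial.eval (v + s • z) (perPoly (Fin 4) K) =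
        (Matrix.fromBlocks ((s * 0) • (1 : Matrix Unit Unit K))
          (Matrix.replicateRow Unit (s • bL z)) (Matrix.replicateCol Unit (s • bL z))
          (D + CL v + s • CL z)).det)
    (embV : (Fin 4 → K) →ₗ[K] (Fin 4 × Fin 4 → K))
    (embX : (Fin 3 → Fin 4 → K) →ₗ[K] (Fin 4 × Fin 4 → K))
    (hper : ∀ (w' : Fin 4 → K) (x : Fin 3 → Fin 4 → K) (s : K),
      MvPolynomial.eval (embV w' + s • embX x) (perPoly (Fin 4) K) =
        s ^ 3 * (Matrix.of ![w', x 0, x 1, x 2]).permanent)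
    (w w₀ : Fin 4 → K) (hw : bL (embV w) = 0)
    (Kw : (Fin 3 → Fin 4 → K) →ₗ[K] (Fin 3 → Fin 4 → K)) (cw : (Fin 3 → Fin 4 → K) →ₗ[K] K)
    (hKc : ∀ x, bL (embX (Kw x)) + cw x • bL (embV w₀) =
      CL (embV w) *ᵥ (D⁻¹ *ᵥ bL (embX x))) :
    ∀ (x : Fin 3 → Fin 4 → K) (t : K),
      (D + t • CL (embV w)).det *
          (t * ((D⁻¹ *ᵥ bL (embX x)) ⬝ᵥ CL (embX (Kw x) + cw x • embV w₀) *ᵥ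
            (D⁻¹ *ᵥ bL (embX x)))) =
        κ * t * (Matrix.of ![w, (x + t • Kw x) 0, (x + t • Kw x) 1,
          (x + t • Kw x) 2]).permanent := by
  classical
  intro x t
  have hDis : (D⁻¹)ᵀ = D⁻¹ := by rw [Matrix.transpose_nonsing_inv, hDs]
  set u : ι' → K := D⁻¹ *ᵥ bL (embX x) with hu
  have hDu : D *ᵥ u = bL (embX x) := by
    rw [hu, Matrix.mulVec_mulVec, Matrix.mul_nonsing_inv _ hD, Matrix.one_mulVec]
  have hΘ0 : u ⬝ᵥ CL (embX x) *ᵥ u = 0 := by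
    have h := hii (embX x)
    rwa [sandwich₂_eq hDis] at h
  set z₁ : Fin 4 × Fin 4 → K := embX (Kw x) + cw x • embV w₀ with hz₁
  have hbz₁ : bL z₁ = CL (embV w) *ᵥ u := by
    rw [hz₁, map_add, map_smul]
    exact hKc x
  obtain ⟨hNt, hdet⟩ := hN (t • embV w) (by rw [map_smul, hw, smul_zero])
  have hCt : CL (t • embV w) = t • CL (embV w) := by rw [map_smul]
  set z : Fin 4 × Fin 4 → K := embX x + t • z₁ with hz
  have hbz : bL z = (D + CL (t • embV w)) *ᵥ u := by
    rw [hz, map_add, map_smul, hbz₁, hCt, Matrix.add_mulVec, hDu, Matrix.smul_mulVec]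
  have hNs : (D + CL (t • embV w))ᵀ = D + CL (t • embV w) := by
    rw [Matrix.transpose_add, hDs, hCs]
  have hpt : ∀ s : K, t • embV w + s • z =
      embV (t • w + (s * t * cw x) • w₀) + s • embX (x + t • Kw x) := by
    intro s
    rw [hz, hz₁]
    funext p
    simp only [Pi.add_apply, Pi.smul_apply, smul_eq_mul, map_add, map_smul]
    ring
  have hE : ∀ s : K, (Matrix.fromBlocks ((s * 0) • (1 : Matrix Unit Unit K))
      (Matrix.replicateRow Unit (s • (D + CL (t • embV w)) *ᵥ u))
      (Matrix.replicateCol Unit (s • (D + CL (t • embV w)) *ᵥ u))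
      (D + CL (t • embV w) + s • CL z)).det =
      s ^ 3 * (κ * t * (Matrix.of ![w, (x + t • Kw x) 0, (x + t • Kw x) 1,
        (x + t • Kw x) 2]).permanent) +
      s ^ 4 * (κ * t * cw x * (Matrix.of ![w₀, (x + t • Kw x) 0, (x + t • Kw x) 1,
        (x + t • Kw x) 2]).permanent) := by
    intro s
    rw [← hbz, ← hdet z s, hpt s, hper, per_add_row₀, permanent_rows_smul₀,
      permanent_rows_smul₀]
    ring
  obtain ⟨-, -, h3⟩ := basepoint_moment hNt hNs 0 _ _ u hE
  have hq : u ⬝ᵥ CL z *ᵥ u = t * (u ⬝ᵥ CL z₁ *ᵥ u) := by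
    rw [hz, map_add, map_smul, Matrix.add_mulVec, dotProduct_add, hΘ0, zero_add,
      Matrix.smul_mulVec, dotProduct_smul, smul_eq_mul]
  rw [hq, hCt] at h3
  rw [h3]

/-- **The `t⁰`- and `t¹`-coefficients of the pencil identity**: (K0) `det D · Φ(x) = κ per [w; x]`
and (K1) `δ₁ · Φ(x) = κ · DF_w(x)[K x]` with `δ₁` the `t`-coefficient of `det (D + t C₀)`.
[folklore] -/
theorem pencil_coeffs {D C₀ : Matrix ι' ι' K} {κ : K} {w : Fin 4 → K}
    (Φ : (Fin 3 → Fin 4 → K) → K) (Kw : (Fin 3 → Fin 4 → K) →ₗ[K] (Fin 3 → Fin 4 → K))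
    (hmain : ∀ (x : Fin 3 → Fin 4 → K) (t : K), (D + t • C₀).det * (t * Φ x) =
      κ * t * (Matrix.of ![w, (x + t • Kw x) 0, (x + t • Kw x) 1, (x + t • Kw x) 2]).permanent)
    (x : Fin 3 → Fin 4 → K) :
    D.det * Φ x = κ * (Matrix.of ![w, x 0, x 1, x 2]).permanent ∧
      (D.map Polynomial.C + (Polynomial.X : K[X]) • C₀.map Polynomial.C).det.coeff 1 * Φ x =
        κ * ((Matrix.of ![w, Kw x 0, x 1, x 2]).permanent +
          (Matrix.of ![w, x 0, Kw x 1, x 2]).permanent +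
          (Matrix.of ![w, x 0, x 1, Kw x 2]).permanent) := by
  classical
  set y := Kw x with hy
  set Θ₀ := Φ x with hΘ₀
  set F₀ := (Matrix.of ![w, x 0, x 1, x 2]).permanent with hF₀
  set F₁ := (Matrix.of ![w, y 0, x 1, x 2]).permanent +
    (Matrix.of ![w, x 0, y 1, x 2]).permanent + (Matrix.of ![w, x 0, x 1, y 2]).permanent with hF₁
  set F₂ := (Matrix.of ![w, x 0, y 1, y 2]).permanent +
    (Matrix.of ![w, y 0, x 1, y 2]).permanent + (Matrix.of ![w, y 0, y 1, x 2]).permanent with hF₂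
  set F₃ := (Matrix.of ![w, y 0, y 1, y 2]).permanent with hF₃
  set δ : K[X] := (D.map Polynomial.C + (Polynomial.X : K[X]) • C₀.map Polynomial.C).det with hδ
  set Q : K[X] := Polynomial.C Θ₀ * δ - Polynomial.C κ * (Polynomial.C F₀ +
    Polynomial.C F₁ * Polynomial.X + Polynomial.C F₂ * Polynomial.X ^ 2 +
    Polynomial.C F₃ * Polynomial.X ^ 3) with hQ
  have hroot : ∀ t : K, t ≠ 0 → Q.IsRoot t := by
    intro t ht
    have h := hmain x t
    simp only [Pi.add_apply, Pi.smul_apply] at h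
    rw [permanent_rows_add_smul] at h
    rw [Polynomial.IsRoot.def, hQ]
    simp only [Polynomial.eval_sub, Polynomial.eval_mul, Polynomial.eval_C, Polynomial.eval_add,
      Polynomial.eval_X, Polynomial.eval_pow]
    rw [hδ, eval_detLine]
    have h' : t * (Θ₀ * (D + t • C₀).det -
        κ * (F₀ + F₁ * t + F₂ * t ^ 2 + F₃ * t ^ 3)) = 0 := by
      rw [hΘ₀, hF₀, hF₁, hF₂, hF₃, hy]
      linear_combination h
    exact (mul_eq_zero.1 h').resolve_left ht
  have hQ0 : Q = 0 := by
    apply Polynomial.eq_zero_of_infinite_isRoot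
    refine ((Set.finite_singleton (0 : K)).infinite_compl).mono fun t ht => ?_
    exact hroot t ht
  obtain ⟨c0, c1⟩ := coeff_cubic F₀ F₁ F₂ F₃
  have e0 : Q.coeff 0 = 0 := by rw [hQ0, Polynomial.coeff_zero]
  have e1 : Q.coeff 1 = 0 := by rw [hQ0, Polynomial.coeff_zero]
  rw [hQ, Polynomial.coeff_sub, Polynomial.coeff_C_mul, Polynomial.coeff_C_mul] at e0 e1
  rw [c0, hδ, coeff_detLine_zero] at e0
  rw [c1] at e1
  constructor
  · linear_combination e0
  · linear_combination e1

/-- **No one-row kernel row with invariance and a thirteen-type range.**  See the module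
docstring. [folklore] -/
theorem false_of_oneRow_point {D : Matrix ι' ι' K} (hD : IsUnit D.det) (hDs : Dᵀ = D)
    (bL : (Fin 4 × Fin 4 → K) →ₗ[K] (ι' → K))
    (CL : (Fin 4 × Fin 4 → K) →ₗ[K] Matrix ι' ι' K) (hCs : ∀ z, (CL z)ᵀ = CL z)
    {κ : K} (hκ : κ ≠ 0)
    (hii : ∀ z, bL z ⬝ᵥ (D⁻¹ * CL z * D⁻¹) *ᵥ bL z = 0)
    (hN : ∀ v, bL v = 0 → IsUnit (D + CL v).det ∧ ∀ (z : Fin 4 × Fin 4 → K) (s : K),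
      κ * MvPolynomial.eval (v + s • z) (perPoly (Fin 4) K) =
        (Matrix.fromBlocks ((s * 0) • (1 : Matrix Unit Unit K))
          (Matrix.replicateRow Unit (s • bL z)) (Matrix.replicateCol Unit (s • bL z))
          (D + CL v + s • CL z)).det)
    (embV : (Fin 4 → K) →ₗ[K] (Fin 4 × Fin 4 → K))
    (embX : (Fin 3 → Fin 4 → K) →ₗ[K] (Fin 4 × Fin 4 → K))
    (w w₀ : Fin 4 → K) (hw : bL (embV w) = 0) (hv : ∀ j, w j ≠ 0)
    (hEXr : ∀ z, ∃ (x : Fin 3 → Fin 4 → K) (c : K), bL (embX x) + c • bL (embV w₀) = bL z)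
    (hinv : ∀ y ∈ LinearMap.range bL, CL (embV w) *ᵥ (D⁻¹ *ᵥ y) ∈ LinearMap.range bL)
    (hper : ∀ (w' : Fin 4 → K) (x : Fin 3 → Fin 4 → K) (s : K),
      MvPolynomial.eval (embV w' + s • embX x) (perPoly (Fin 4) K) =
        s ^ 3 * (Matrix.of ![w', x 0, x 1, x 2]).permanent) :
    False := by
  classical
  have hD0 : D.det ≠ 0 := hD.ne_zero
  -- the vector `u(x) = D⁻¹ bL (embX x)`
  let uL : (Fin 3 → Fin 4 → K) →ₗ[K] (ι' → K) := (D⁻¹).mulVecLin ∘ₗ bL ∘ₗ embX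
  have hu : ∀ x, uL x = D⁻¹ *ᵥ bL (embX x) := fun x => rfl
  -- a linear section of `(x, c) ↦ bL (embX x) + c • n` onto `im bL`
  set n : ι' → K := bL (embV w₀) with hn
  have hmemΨ : ∀ p : (Fin 3 → Fin 4 → K) × K,
      ((bL ∘ₗ embX).coprod (LinearMap.toSpanSingleton K (ι' → K) n)) p ∈ LinearMap.range bL := by
    intro p
    refine ⟨embX p.1 + p.2 • embV w₀, ?_⟩
    rw [LinearMap.coprod_apply, LinearMap.comp_apply, LinearMap.toSpanSingleton_apply, map_add,
      map_smul]
  let Ψ : ((Fin 3 → Fin 4 → K) × K) →ₗ[K] LinearMap.range bL :=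
    LinearMap.codRestrict (LinearMap.range bL) _ hmemΨ
  have hΨ : ∀ p : (Fin 3 → Fin 4 → K) × K, (Ψ p : ι' → K) = bL (embX p.1) + p.2 • n := fun p => by
    show ((bL ∘ₗ embX).coprod (LinearMap.toSpanSingleton K (ι' → K) n)) p = _
    rw [LinearMap.coprod_apply, LinearMap.comp_apply, LinearMap.toSpanSingleton_apply]
  have hΨsurj : LinearMap.range Ψ = ⊤ := by
    rw [LinearMap.range_eq_top]
    rintro ⟨y, z, rfl⟩
    obtain ⟨x, c, hxc⟩ := hEXr z
    exact ⟨(x, c), Subtype.ext (by rw [hΨ]; exact hxc)⟩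
  obtain ⟨σ, hσ⟩ := Ψ.exists_rightInverse_of_surjective hΨsurj
  -- the maps `K` and `c`: `bL (embX (K x)) + c x • n = CL(embV w) u(x)`
  let g : (Fin 3 → Fin 4 → K) →ₗ[K] LinearMap.range bL :=
    LinearMap.codRestrict (LinearMap.range bL) ((CL (embV w)).mulVecLin ∘ₗ uL)
      fun x => hinv _ (LinearMap.mem_range_self bL (embX x))
  have hg : ∀ x, (g x : ι' → K) = CL (embV w) *ᵥ uL x := fun x => rfl
  let Kw : (Fin 3 → Fin 4 → K) →ₗ[K] (Fin 3 → Fin 4 → K) := LinearMap.fst K _ _ ∘ₗ σ ∘ₗ g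
  let cw : (Fin 3 → Fin 4 → K) →ₗ[K] K := LinearMap.snd K _ _ ∘ₗ σ ∘ₗ g
  have hKc : ∀ x, bL (embX (Kw x)) + cw x • bL (embV w₀) =
      CL (embV w) *ᵥ (D⁻¹ *ᵥ bL (embX x)) := by
    intro x
    have h1 : ((Ψ.comp σ) (g x) : ι' → K) = (g x : ι' → K) := by rw [hσ, LinearMap.id_apply]
    rw [LinearMap.comp_apply, hΨ, hg] at h1
    rw [← hn]
    exact h1
  -- the pencil identity and its first two coefficients
  let Φ : (Fin 3 → Fin 4 → K) → K := fun x =>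
    (D⁻¹ *ᵥ bL (embX x)) ⬝ᵥ CL (embX (Kw x) + cw x • embV w₀) *ᵥ (D⁻¹ *ᵥ bL (embX x))
  have hmain : ∀ (x : Fin 3 → Fin 4 → K) (t : K),
      (D + t • CL (embV w)).det * (t * Φ x) =
        κ * t * (Matrix.of ![w, (x + t • Kw x) 0, (x + t • Kw x) 1,
          (x + t • Kw x) 2]).permanent :=
    pencil_identity hD hDs bL CL hCs hii hN embV embX hper w w₀ hw Kw cw hKc
  have hK01 := pencil_coeffs Φ Kw hmain
  set δ₁ : K :=
    (D.map Polynomial.C + (Polynomial.X : K[X]) • (CL (embV w)).map Polynomial.C).det.coeff 1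
    with hδ₁def
  -- Euler and the stabiliser: `K` is a row scaling `d`
  obtain ⟨s, e3⟩ : ∃ s : K, D.det * (3 * s) = δ₁ := ⟨δ₁ / (3 * D.det), by field_simp⟩
  set X : (Fin 3 → Fin 4 → K) →ₗ[K] (Fin 3 → Fin 4 → K) := Kw - s • LinearMap.id with hXdef
  have hXa : ∀ x a, X x a = Kw x a - s • x a := fun x a => by
    simp [hXdef, LinearMap.sub_apply, LinearMap.smul_apply]
  have hX : ∀ x : Fin 3 → Fin 4 → K,
      (Matrix.of ![w, X x 0, x 1, x 2]).permanent + (Matrix.of ![w, x 0, X x 1, x 2]).permanent +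
        (Matrix.of ![w, x 0, x 1, X x 2]).permanent = 0 := by
    intro x
    have e := permanent_rows_deriv_sub_smul w x (Kw x) s
    obtain ⟨a0, a1⟩ := hK01 x
    rw [hXa, hXa, hXa, e]
    have h2 : (D.det * κ) * (((Matrix.of ![w, Kw x 0, x 1, x 2]).permanent +
        (Matrix.of ![w, x 0, Kw x 1, x 2]).permanent +
        (Matrix.of ![w, x 0, x 1, Kw x 2]).permanent) -
        3 * s * (Matrix.of ![w, x 0, x 1, x 2]).permanent) = 0 := by
      linear_combination (-D.det) * a1 + (3 * s * D.det) * a0 - (D.det * Φ x) * e3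
    exact (mul_eq_zero.1 h2).resolve_left (mul_ne_zero hD0 hκ)
  obtain ⟨α, -, hα⟩ := rowScaling_of_deriv_vanish hv X hX
  set d : Fin 3 → K := fun a => α a + s with hddef
  have hKd : ∀ x a, Kw x a = d a • x a := fun x a => by
    have h := hα x a
    rw [hXa, sub_eq_iff_eq_add] at h
    rw [h, hddef, add_smul]
  by_cases hda : ∃ a, d a ≠ 0
  · -- some `d_a ≠ 0`: the pencil determinant vanishes at `t = -1/d_a`
    obtain ⟨a, ha⟩ := hda
    set t₀ : K := -(d a)⁻¹ with ht₀
    have ht₀0 : t₀ ≠ 0 := neg_ne_zero.2 (inv_ne_zero ha)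
    have hfac : 1 + t₀ * d a = 0 := by rw [ht₀, neg_mul, inv_mul_cancel₀ ha, add_neg_cancel]
    have hzero : ∀ x : Fin 3 → Fin 4 → K,
        (Matrix.of ![w, (x + t₀ • Kw x) 0, (x + t₀ • Kw x) 1, (x + t₀ • Kw x) 2]).permanent = 0 := by
      intro x
      have hrow : ∀ b, (x + t₀ • Kw x) b = (1 + t₀ * d b) • x b := fun b => by
        rw [Pi.add_apply, Pi.smul_apply, hKd, smul_smul, add_smul, one_smul]
      rw [hrow, hrow, hrow, permanent_rows_scale w x d t₀]
      have h3 : a = 0 ∨ a = 1 ∨ a = 2 := by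
        rcases a with ⟨_ | _ | _ | n, hn⟩
        · exact Or.inl rfl
        · exact Or.inr (Or.inl rfl)
        · exact Or.inr (Or.inr rfl)
        · omega
      rcases h3 with rfl | rfl | rfl
      · rw [hfac]; ring
      · rw [hfac]; ring
      · rw [hfac]; ring
    have hΦ0 : ∀ x, Φ x = 0 := fun x => by
      have h := hmain x t₀
      rw [hzero, mul_zero] at h
      have hNt := (hN (t₀ • embV w) (by rw [map_smul, hw, smul_zero])).1
      rw [map_smul] at hNt
      rcases mul_eq_zero.1 h with h1 | h1
      · exact absurd h1 hNt.ne_zero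
      · exact (mul_eq_zero.1 h1).resolve_left ht₀0
    have hF0 : ∀ x : Fin 3 → Fin 4 → K, (Matrix.of ![w, x 0, x 1, x 2]).permanent = 0 :=
      fun x => by
      have h := (hK01 x).1
      rw [hΦ0, mul_zero] at h
      exact (mul_eq_zero.1 h.symm).resolve_left hκ
    have h := hF0 ![Pi.single 1 1, Pi.single 2 1, Pi.single 3 1]
    simp only [Matrix.cons_val_zero, Matrix.cons_val_one, Matrix.cons_val_two, Matrix.head_cons,
      Matrix.tail_cons] at h
    rw [permanent_rows_three_single w 1 2 3 0 (by decide)] at h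
    exact hv 0 h
  · -- `d = 0`: `K = 0`, and (K0) factors `per [w; ·]` as `linear × quadratic`
    push Not at hda
    have hK0 : ∀ x, Kw x = 0 := fun x => by
      funext b
      rw [hKd, hda b, zero_smul, Pi.zero_apply]
    let Bq : (Fin 3 → Fin 4 → K) →ₗ[K] (Fin 3 → Fin 4 → K) →ₗ[K] K :=
      (Matrix.toLinearMap₂' K (CL (embV w₀))).compl₁₂ uL uL
    have hBq : ∀ x y, Bq x y = uL x ⬝ᵥ CL (embV w₀) *ᵥ uL y := fun x y => by
      simp only [Bq, LinearMap.compl₁₂_apply, Matrix.toLinearMap₂'_apply']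
    have hΦ : ∀ x, Φ x = cw x * Bq x x := fun x => by
      show (D⁻¹ *ᵥ bL (embX x)) ⬝ᵥ CL (embX (Kw x) + cw x • embV w₀) *ᵥ (D⁻¹ *ᵥ bL (embX x)) = _
      rw [hK0, map_zero, zero_add, map_smul, Matrix.smul_mulVec, dotProduct_smul, smul_eq_mul,
        hBq, hu]
    refine permanent_rows_ne_linear_mul_quadratic (w := w) (Function.ne_iff.2 ⟨0, hv 0⟩)
      ((D.det / κ) • cw) Bq fun x => ?_
    have h := (hK01 x).1
    rw [hΦ] at h
    rw [LinearMap.smul_apply, smul_eq_mul, div_mul_eq_mul_div, div_mul_eq_mul_div, eq_div_iff hκ]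
    linear_combination -h

end Summit.ValiantsHypothesis.ValiantsHypothesis.Theorems.SymPencilPerFourOneRowPoint

end
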